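import Summits.CriticalPhenomena.CardyFormulaZ2.Theorems.CardyComplexConeParafermionToSLESixFamiliesDiamondTurnCountSafe
import Summits.CriticalPhenomena.CardyFormulaZ2.Theorems.CardyComplexConeParafermionToSLESixFamiliesDiamondTurnCountRoutes
import Summits.CriticalPhenomena.CardyFormulaZ2.Theorems.CardyComplexConeParafermionToSLESixFamiliesDiamondTurnCountRouteEast
import Summits.CriticalPhenomena.CardyFormulaZ2.Theorems.CardyComplexConeParafermionToSLESixFamiliesDiamondTurnCountGeom
import HarnessLib

/-!
# The escape staircase of a touch site, VII: choosing the route from the position of the start edge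
# (line `potential-darboux-picard-diamond`, S1t `stub_freeSideTurnCount`, part 11)

Crux `ParafermionToSLESixFamilies` (stmt-CriticalPhenomena-11389), line `potential-darboux-picard-diamond`, stub
`stub_freeSideTurnCount` (S1t). The outer corner `p⋆` of the start edge is an outside lattice point within `ε + 3δ` of a
mark `a` of the domain, a frontier point off the open boundary segment `(p, q) ⊆` side `k`. `route_select` (registered)
chooses the route `Q` from the far corner `(K, -K)` of the frame box to `p⋆` — EAST if `p⋆` is beyond the next side, TOP if
beyond the opposite side, BOTTOM if beyond the previous side, and, if `p⋆` is beyond side `k` itself, EAST or BOTTOM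
according as `a` comes after `q` or before `p` along the side (`tangential_dichotomy_of_not_mem_openSegment`) — and proves,
uniformly in the touch site `u` of the `η`-trimmed segment (given only through its frame coordinates), that the spur of
the route is outside the diamond and that every route vertex is safe for the prefix of `u` (the separation inequalities
of `…DiamondTurnCountSafe.lean`, from `ε ≤ η/16`, `δ ≤ η/100`). The output is the route interface consumed by the
assembly: a first step west, end vertex and last direction of the gadget, vertex classes `C` of outside sites, no repeated
vertex, the end vertex new, the side functional bound off the far corner, and safety.
-/

noncomputable section

namespace Summit.CriticalPhenomena.CardyFormulaZ2.Cruxes.ParafermionToSLESixFamilies.PotentialDarbouxPicardDiamond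

open Set Metric Complex
open Literature.Probability Literature.Probability.LatticeModels
open Literature.Probability.RandomPlanarGeometry

/-- **Route selection** (registered helper of `stub_freeSideTurnCount`). See the module docstring. -/
theorem route_select : ∀ (D : DobrushinDomain) (c : ℂ) (α β : ℝ), D.carrier = {z | |((z - c) * exp (-(Real.pi / 4 : ℝ) * I)).re| < α ∧ |((z - c) * exp (-(Real.pi / 4 : ℝ) * I)).im| < β} → ∀ (k : Fin 4) (sp sq : ℝ) (p q : ℂ), 0 ≤ sp → sp < sq → sq ≤ dLen α β k → dRot c p = dParam α β k sp → dRot c q = dParam α β k sq → ∀ (δ η ε : ℝ), 0 < δ → 100 * δ ≤ η → 16 * ε ≤ η → 16 * ε ≤ gam α β k → 10 * δ ≤ gam α β k → ∀ (ι : Site 2 → ℤ), (∀ v : Site 2, meshPoint δ v ∉ D.carrier → ι v = 0) → (∀ v : Site 2, meshPoint δ v ∈ D.carrier → ι v = 1) → ∀ (K₀ : ℕ), (∀ v : Site 2, meshPoint δ v ∈ D.carrier → |xiC k v| ≤ K₀ ∧ |upC k v| ≤ K₀) → (∀ v : Site 2, (xiC k v = 3 * K₀ + 10 ∨ xiC k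 v = -(3 * K₀ + 10) ∨ upC k v = 3 * K₀ + 10 ∨ upC k v = -(3 * K₀ + 10)) → meshPoint δ v ∉ D.carrier) → ∀ (ps : Site 2), meshPoint δ ps ∉ D.carrier → ∀ (a : ℂ), a ∈ frontier D.carrier → a ∉ openSegment ℝ p q → dist (meshPoint δ ps) a ≤ ε + 3 * δ → ∀ (gds : List (Fin 4)), gds ≠ [] → (∀ v ∈ pathVerts ps gds, v = ps ∨ (meshPoint δ v ∈ D.carrier ∧ |xiC k v - xiC k ps| ≤ 1 ∧ |upC k v - upC k ps| ≤ 1)) → (pathVerts ps gds).Nodup → meshPoint δ (pathEnd ps gds) ∈ D.carrier → pathEnd ps gds ∉ pathVerts ps gds → |xiC k (pathEnd ps gds) - xiC k ps| ≤ 1 ∧ |upC k (pathEnd ps gds) - upC k ps| ≤ 1 → ∃ (Q : List (Fin 4)) (C : Site 2 → Prop), (∀ v : Site 2, C v → ι v = 0) ∧ (∀ vs : Site 2, xiC k vs = 3 * K₀ + 10 → upC k vs = -(3 * K₀ + 10) → ∃ Qt : List (Fin 4), Q = (k + 2) :: Qt ∧ pathEnd vs Q = pathEnd ps gds ∧ lastDir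 Q = lastDir gds ∧ (∀ v ∈ pathVerts vs Q, C v ∨ v ∈ pathVerts ps gds) ∧ (pathVerts vs Q).Nodup ∧ pathEnd ps gds ∉ pathVerts vs Q ∧ (∀ b ∈ pathVerts vs Q, b = vs ∨ xiC k b - upC k b ≤ 2 * (3 * K₀ + 10) - 1)) ∧ (∀ u : Site 2, gam α β k - 3 * δ ≤ Fk k (dRot c (meshPoint δ u)) → Fk k (dRot c (meshPoint δ u)) < gam α β k → sp + η - 6 * δ - gam' α β k ≤ Gk k (dRot c (meshPoint δ u)) → Gk k (dRot c (meshPoint δ u)) ≤ sq - η + 6 * δ - gam' α β k → meshPoint δ u ∈ D.carrier → (∀ v : Site 2, C v → SafeVertex k u (3 * K₀ + 10) ι v) ∧ (∀ v ∈ pathVerts ps gds, SafeVertex k u (3 * K₀ + 10) ι v)) := by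
  intro D c α β hcar k sp sq p q hsp0 hspq hsqL hpk hqk δ η ε hδ hδη hεη hεγ hδγ ι hι0 hι1 K₀ hK₀in hK₀out ps hpsout a ha haseg hpa
    gds hgds hgV hgnd hx1 hx2 hx3
  have hcar' : D.carrier = {z | |(dRot c z).re| < α ∧ |(dRot c z).im| < β} := hcar
  rw [dLen_eq] at hsqL
  set K : ℤ := 3 * K₀ + 10 with hK
  set Fp := Fk k (dRot c (meshPoint δ ps)) with hFp
  set Gp := Gk k (dRot c (meshPoint δ ps)) with hGp
  set Fa := Fk k (dRot c a) with hFa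
  set Ga := Gk k (dRot c a) with hGa
  obtain ⟨hh1, hh2⟩ := sqrt_two_div_two_mul_bounds hδ
  -- `p⋆` versus the mark
  have hρ : ‖dRot c (meshPoint δ ps) - dRot c a‖ ≤ ε + 3 * δ := by rw [← dist_eq_norm, dist_dRot]; exact hpa
  have hρF := (abs_le.1 ((abs_Fk_sub_le k _ _).trans hρ))
  have hρG := (abs_le.1 ((abs_Gk_sub_le k _ _).trans hρ))
  obtain ⟨hFa1, hGa1, hbd⟩ := frame_of_mem_frontier hcar' k ha
  have hFa2 := abs_le.1 hFa1
  have hGa2 := abs_le.1 hGa1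
  -- outside facts in `ι` form
  have hιp : ι ps = 0 := hι0 _ hpsout
  have hιfar : ∀ v : Site 2, (xiC k v = K ∨ xiC k v = -K ∨ upC k v = K ∨ upC k v = -K) → ι v = 0 :=
    fun v h => hι0 v (hK₀out v h)
  have hgV' : ∀ v ∈ pathVerts ps gds, v = ps ∨ (ι v = 1 ∧ |xiC k v - xiC k ps| ≤ 1 ∧ |upC k v - upC k ps| ≤ 1) := by
    intro v hv
    rcases hgV v hv with h | ⟨h1, h2, h3⟩
    · exact Or.inl h
    · exact Or.inr ⟨hι1 v h1, h2, h3⟩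
  have hιx : ι (pathEnd ps gds) = 1 := hι1 _ hx1
  -- coordinates of `p⋆`
  obtain ⟨hx0a, hx0b⟩ := hK₀in _ hx1
  have hp1 : |xiC k ps| ≤ K - 2 := by
    have := hx3.1; rw [abs_le] at this hx0a ⊢; constructor <;> omega
  have hp2 : |upC k ps| ≤ K - 2 := by
    have := hx3.2; rw [abs_le] at this hx0b ⊢; constructor <;> omega
  have hp1' : |xiC k ps| ≤ K₀ + 1 := by
    have := hx3.1; rw [abs_le] at this hx0a ⊢; constructor <;> omega
  have hp2' : |upC k ps| ≤ K₀ + 1 := by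
    have := hx3.2; rw [abs_le] at this hx0b ⊢; constructor <;> omega
  -- gadget vertices are safe as soon as the separation holds (three forms)
  have hgadget : ∀ u v : Site 2, v ∈ pathVerts ps gds →
      (xiC k v = xiC k ps ∧ upC k v = upC k ps ∧ ι v = 0) ∨ (ι v = 1 ∧ |xiC k v - xiC k ps| ≤ 1 ∧ |upC k v - upC k ps| ≤ 1) := by
    intro u v hv
    rcases hgV' v hv with rfl | h
    · exact Or.inl ⟨rfl, rfl, hιp⟩
    · exact Or.inr h
  -- frame differences between `p⋆` and a site `u`, and the coordinates of `u`
  have hdiff : ∀ u : Site 2, Fp - Fk k (dRot c (meshPoint δ u)) =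
      Real.sqrt 2 / 2 * δ * ((xiC k ps - upC k ps - (xiC k u - upC k u) : ℤ) : ℝ) ∧
      Gp - Gk k (dRot c (meshPoint δ u)) = Real.sqrt 2 / 2 * δ * ((xiC k ps + upC k ps - (xiC k u + upC k u) : ℤ) : ℝ) :=
    fun u => ⟨Fk_meshPoint_sub c δ k ps u, Gk_meshPoint_sub c δ k ps u⟩
  ---------------------------------------------------------------- EAST
  have hEAST : (gam' α β k ≤ Gp ∨ (gam α β k ≤ Fp ∧ sq - gam' α β k ≤ Ga)) → ∃ (Q : List (Fin 4)) (C : Site 2 → Prop),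
      (∀ v : Site 2, C v → ι v = 0) ∧ (∀ vs : Site 2, xiC k vs = K → upC k vs = -K → ∃ Qt : List (Fin 4), Q = (k + 2) :: Qt ∧
        pathEnd vs Q = pathEnd ps gds ∧ lastDir Q = lastDir gds ∧ (∀ v ∈ pathVerts vs Q, C v ∨ v ∈ pathVerts ps gds) ∧
        (pathVerts vs Q).Nodup ∧ pathEnd ps gds ∉ pathVerts vs Q ∧ (∀ b ∈ pathVerts vs Q, b = vs ∨ xiC k b - upC k b ≤ 2 * K - 1)) ∧
      (∀ u : Site 2, gam α β k - 3 * δ ≤ Fk k (dRot c (meshPoint δ u)) → Fk k (dRot c (meshPoint δ u)) < gam α β k →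
        sp + η - 6 * δ - gam' α β k ≤ Gk k (dRot c (meshPoint δ u)) → Gk k (dRot c (meshPoint δ u)) ≤ sq - η + 6 * δ - gam' α β k →
        meshPoint δ u ∈ D.carrier → (∀ v : Site 2, C v → SafeVertex k u K ι v) ∧ (∀ v ∈ pathVerts ps gds, SafeVertex k u K ι v)) := by
    intro hcase
    -- the spur to the right of `p⋆` is outside
    have hιsp : ∀ v : Site 2, upC k v = upC k ps → xiC k ps + 1 ≤ xiC k v → ι v = 0 := by
      intro v hv1 hv2
      apply hι0
      apply not_mem_carrier_of_frame hcar' k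
      obtain ⟨eF, eG⟩ := hdiff v
      have hpos : (1 : ℝ) ≤ ((xiC k v - upC k v - (xiC k ps - upC k ps) : ℤ) : ℝ) := by exact_mod_cast (by omega)
      have hpos' : (1 : ℝ) ≤ ((xiC k v + upC k v - (xiC k ps + upC k ps) : ℤ) : ℝ) := by exact_mod_cast (by omega)
      have e1 : Fk k (dRot c (meshPoint δ v)) - Fp = Real.sqrt 2 / 2 * δ * ((xiC k v - upC k v - (xiC k ps - upC k ps) : ℤ) : ℝ) :=
        Fk_meshPoint_sub c δ k v ps
      have e2 : Gk k (dRot c (meshPoint δ v)) - Gp = Real.sqrt 2 / 2 * δ * ((xiC k v + upC k v - (xiC k ps + upC k ps) : ℤ) : ℝ) :=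
        Gk_meshPoint_sub c δ k v ps
      have m1 : Real.sqrt 2 / 2 * δ * 1 ≤ Real.sqrt 2 / 2 * δ * ((xiC k v - upC k v - (xiC k ps - upC k ps) : ℤ) : ℝ) :=
        mul_le_mul_of_nonneg_left hpos (by positivity)
      have m2 : Real.sqrt 2 / 2 * δ * 1 ≤ Real.sqrt 2 / 2 * δ * ((xiC k v + upC k v - (xiC k ps + upC k ps) : ℤ) : ℝ) :=
        mul_le_mul_of_nonneg_left hpos' (by positivity)
      rcases hcase with hG | ⟨hF, -⟩
      · right; right; left; linarith
      · left; linarith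
    obtain hdata := fun vs (h1 : xiC k vs = K) (h2 : upC k vs = -K) =>
      routeEast_data k K ι vs ps gds h1 h2 hp1 hp2 hgds hgV' hgnd hιp hιfar hιsp hιx hx2
    refine ⟨routeEast k K ps gds, fun v => (upC k v = -K ∧ -K + 1 ≤ xiC k v ∧ xiC k v ≤ K ∧ ι v = 0) ∨
        (xiC k v = -K ∧ -K ≤ upC k v ∧ upC k v ≤ K - 1 ∧ ι v = 0) ∨ (upC k v = K ∧ -K ≤ xiC k v ∧ xiC k v ≤ K - 1 ∧ ι v = 0) ∨
        (xiC k v = K ∧ upC k ps + 1 ≤ upC k v ∧ upC k v ≤ K ∧ ι v = 0) ∨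
        (upC k v = upC k ps ∧ xiC k ps + 1 ≤ xiC k v ∧ xiC k v ≤ K ∧ ι v = 0), ?_, ?_, ?_⟩
    · rintro v (h | h | h | h | h) <;> exact h.2.2.2
    · intro vs h1 h2
      obtain ⟨Qt, hQ, hend, hlast, hmem, hnd, hnew, hreg⟩ := hdata vs h1 h2
      refine ⟨Qt, hQ, hend, hlast, fun v hv => ?_, hnd, hnew, hreg⟩
      rcases hmem v hv with h | h | h | h | h | h
      exacts [Or.inl (Or.inl h), Or.inl (Or.inr (Or.inl h)), Or.inl (Or.inr (Or.inr (Or.inl h))),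
        Or.inl (Or.inr (Or.inr (Or.inr (Or.inl h)))), Or.inl (Or.inr (Or.inr (Or.inr (Or.inr h)))), Or.inr h]
    · intro u hFu1 hFu2 hGu1 hGu2 huin
      obtain ⟨hu1, hu2⟩ := hK₀in u huin
      obtain ⟨eF, eG⟩ := hdiff u
      -- the separation `upC u + 4 ≤ upC p⋆`
      have hS : upC k u + 4 ≤ upC k ps := by
        by_contra hc
        have hc' : ((xiC k ps + upC k ps - (xiC k u + upC k u) : ℤ) : ℝ) - ((xiC k ps - upC k ps - (xiC k u - upC k u) : ℤ) : ℝ) ≤ 6 := by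
          have : (((xiC k ps + upC k ps - (xiC k u + upC k u)) - (xiC k ps - upC k ps - (xiC k u - upC k u)) : ℤ) : ℝ) ≤ 6 := by
            exact_mod_cast (by omega)
          push_cast at this ⊢; linarith
        have m : Real.sqrt 2 / 2 * δ * (((xiC k ps + upC k ps - (xiC k u + upC k u) : ℤ) : ℝ) -
            ((xiC k ps - upC k ps - (xiC k u - upC k u) : ℤ) : ℝ)) ≤ Real.sqrt 2 / 2 * δ * 6 :=
          mul_le_mul_of_nonneg_left hc' (by positivity)
        have key : (Gp - Gk k (dRot c (meshPoint δ u))) - (Fp - Fk k (dRot c (meshPoint δ u))) ≤ 6 * δ := by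
          rw [eF, eG, ← mul_sub]; nlinarith
        rcases hcase with hG | ⟨hF, hGa3⟩
        · linarith
        · linarith
      refine ⟨fun v hv => ?_, fun v hv => ?_⟩
      · exact safeVertex_of_east k K K₀ ι u ps v hK hu1 hu2 hp1' hp2' hS (Or.inl hv)
      · exact safeVertex_of_east k K K₀ ι u ps v hK hu1 hu2 hp1' hp2' hS (Or.inr (hgadget u v hv))
  ---------------------------------------------------------------- TOP
  have hTOP : Fp ≤ -gam α β k → ∃ (Q : List (Fin 4)) (C : Site 2 → Prop),
      (∀ v : Site 2, C v → ι v = 0) ∧ (∀ vs : Site 2, xiC k vs = K → upC k vs = -K → ∃ Qt : List (Fin 4), Q = (k + 2) :: Qt ∧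
        pathEnd vs Q = pathEnd ps gds ∧ lastDir Q = lastDir gds ∧ (∀ v ∈ pathVerts vs Q, C v ∨ v ∈ pathVerts ps gds) ∧
        (pathVerts vs Q).Nodup ∧ pathEnd ps gds ∉ pathVerts vs Q ∧ (∀ b ∈ pathVerts vs Q, b = vs ∨ xiC k b - upC k b ≤ 2 * K - 1)) ∧
      (∀ u : Site 2, gam α β k - 3 * δ ≤ Fk k (dRot c (meshPoint δ u)) → Fk k (dRot c (meshPoint δ u)) < gam α β k →
        sp + η - 6 * δ - gam' α β k ≤ Gk k (dRot c (meshPoint δ u)) → Gk k (dRot c (meshPoint δ u)) ≤ sq - η + 6 * δ - gam' α β k →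
        meshPoint δ u ∈ D.carrier → (∀ v : Site 2, C v → SafeVertex k u K ι v) ∧ (∀ v ∈ pathVerts ps gds, SafeVertex k u K ι v)) := by
    intro hcase
    -- the spur above `p⋆` is outside
    have hιsp : ∀ v : Site 2, xiC k v = xiC k ps → upC k ps + 1 ≤ upC k v → ι v = 0 := by
      intro v hv1 hv2
      apply hι0
      apply not_mem_carrier_of_frame hcar' k
      have hneg : ((xiC k v - upC k v - (xiC k ps - upC k ps) : ℤ) : ℝ) ≤ -1 := by exact_mod_cast (by omega)
      have e1 : Fk k (dRot c (meshPoint δ v)) - Fp = Real.sqrt 2 / 2 * δ * ((xiC k v - upC k v - (xiC k ps - upC k ps) : ℤ) : ℝ) :=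
        Fk_meshPoint_sub c δ k v ps
      have m1 : Real.sqrt 2 / 2 * δ * ((xiC k v - upC k v - (xiC k ps - upC k ps) : ℤ) : ℝ) ≤ Real.sqrt 2 / 2 * δ * (-1) :=
        mul_le_mul_of_nonneg_left hneg (by positivity)
      right; left; linarith
    obtain hdata := fun vs (h1 : xiC k vs = K) (h2 : upC k vs = -K) =>
      routeTop_data k K ι vs ps gds h1 h2 hp1 hp2 hgds hgV' hgnd hιp hιfar hιsp hιx hx2
    refine ⟨routeTop k K ps gds, fun v => (upC k v = -K ∧ -K + 1 ≤ xiC k v ∧ xiC k v ≤ K ∧ ι v = 0) ∨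
        (xiC k v = -K ∧ -K ≤ upC k v ∧ upC k v ≤ K - 1 ∧ ι v = 0) ∨ (upC k v = K ∧ -K ≤ xiC k v ∧ xiC k v ≤ xiC k ps - 1 ∧ ι v = 0) ∨
        (xiC k v = xiC k ps ∧ upC k ps + 1 ≤ upC k v ∧ upC k v ≤ K ∧ ι v = 0), ?_, ?_, ?_⟩
    · rintro v (h | h | h | h) <;> exact h.2.2.2
    · intro vs h1 h2
      obtain ⟨Qt, hQ, hend, hlast, hmem, hnd, hnew, hreg⟩ := hdata vs h1 h2
      refine ⟨Qt, hQ, hend, hlast, fun v hv => ?_, hnd, hnew, hreg⟩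
      rcases hmem v hv with h | h | h | h | h
      exacts [Or.inl (Or.inl h), Or.inl (Or.inr (Or.inl h)), Or.inl (Or.inr (Or.inr (Or.inl h))),
        Or.inl (Or.inr (Or.inr (Or.inr h))), Or.inr h]
    · intro u hFu1 hFu2 hGu1 hGu2 huin
      obtain ⟨hu1, hu2⟩ := hK₀in u huin
      obtain ⟨eF, eG⟩ := hdiff u
      -- the separation `N p⋆ ≤ N u - 8`
      have hS : xiC k ps - upC k ps ≤ xiC k u - upC k u - 8 := by
        by_contra hc
        have hc' : (-7 : ℝ) ≤ ((xiC k ps - upC k ps - (xiC k u - upC k u) : ℤ) : ℝ) := by exact_mod_cast (by omega)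
        have m : Real.sqrt 2 / 2 * δ * (-7) ≤ Real.sqrt 2 / 2 * δ * ((xiC k ps - upC k ps - (xiC k u - upC k u) : ℤ) : ℝ) :=
          mul_le_mul_of_nonneg_left hc' (by positivity)
        have key : -(7 * δ) ≤ Fp - Fk k (dRot c (meshPoint δ u)) := by rw [eF]; nlinarith
        linarith
      refine ⟨fun v hv => ?_, fun v hv => ?_⟩
      · exact safeVertex_of_top hK hu2 hp1' hp2' hS (Or.inl hv)
      · exact safeVertex_of_top hK hu2 hp1' hp2' hS (Or.inr (hgadget u v hv))
  ---------------------------------------------------------------- BOTTOM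
  have hBOT : (Gp ≤ -gam' α β k ∨ (gam α β k ≤ Fp ∧ Ga ≤ sp - gam' α β k)) → ∃ (Q : List (Fin 4)) (C : Site 2 → Prop),
      (∀ v : Site 2, C v → ι v = 0) ∧ (∀ vs : Site 2, xiC k vs = K → upC k vs = -K → ∃ Qt : List (Fin 4), Q = (k + 2) :: Qt ∧
        pathEnd vs Q = pathEnd ps gds ∧ lastDir Q = lastDir gds ∧ (∀ v ∈ pathVerts vs Q, C v ∨ v ∈ pathVerts ps gds) ∧
        (pathVerts vs Q).Nodup ∧ pathEnd ps gds ∉ pathVerts vs Q ∧ (∀ b ∈ pathVerts vs Q, b = vs ∨ xiC k b - upC k b ≤ 2 * K - 1)) ∧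
      (∀ u : Site 2, gam α β k - 3 * δ ≤ Fk k (dRot c (meshPoint δ u)) → Fk k (dRot c (meshPoint δ u)) < gam α β k →
        sp + η - 6 * δ - gam' α β k ≤ Gk k (dRot c (meshPoint δ u)) → Gk k (dRot c (meshPoint δ u)) ≤ sq - η + 6 * δ - gam' α β k →
        meshPoint δ u ∈ D.carrier → (∀ v : Site 2, C v → SafeVertex k u K ι v) ∧ (∀ v ∈ pathVerts ps gds, SafeVertex k u K ι v)) := by
    intro hcase
    -- the spur below `p⋆` is outside
    have hιsp : ∀ v : Site 2, xiC k v = xiC k ps → upC k v ≤ upC k ps - 1 → ι v = 0 := by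
      intro v hv1 hv2
      apply hι0
      apply not_mem_carrier_of_frame hcar' k
      have hpos : (1 : ℝ) ≤ ((xiC k v - upC k v - (xiC k ps - upC k ps) : ℤ) : ℝ) := by exact_mod_cast (by omega)
      have hneg : ((xiC k v + upC k v - (xiC k ps + upC k ps) : ℤ) : ℝ) ≤ -1 := by exact_mod_cast (by omega)
      have e1 : Fk k (dRot c (meshPoint δ v)) - Fp = Real.sqrt 2 / 2 * δ * ((xiC k v - upC k v - (xiC k ps - upC k ps) : ℤ) : ℝ) :=
        Fk_meshPoint_sub c δ k v ps
      have e2 : Gk k (dRot c (meshPoint δ v)) - Gp = Real.sqrt 2 / 2 * δ * ((xiC k v + upC k v - (xiC k ps + upC k ps) : ℤ) : ℝ) :=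
        Gk_meshPoint_sub c δ k v ps
      have m1 : Real.sqrt 2 / 2 * δ * 1 ≤ Real.sqrt 2 / 2 * δ * ((xiC k v - upC k v - (xiC k ps - upC k ps) : ℤ) : ℝ) :=
        mul_le_mul_of_nonneg_left hpos (by positivity)
      have m2 : Real.sqrt 2 / 2 * δ * ((xiC k v + upC k v - (xiC k ps + upC k ps) : ℤ) : ℝ) ≤ Real.sqrt 2 / 2 * δ * (-1) :=
        mul_le_mul_of_nonneg_left hneg (by positivity)
      rcases hcase with hG | ⟨hF, -⟩
      · right; right; right; linarith
      · left; linarith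
    obtain hdata := fun vs (h1 : xiC k vs = K) (h2 : upC k vs = -K) =>
      routeBot_data k K ι vs ps gds h1 h2 hp1 hp2 hgds hgV' hgnd hιp hιfar hιsp hιx hx2
    refine ⟨routeBot k K ps gds, fun v => (upC k v = -K ∧ xiC k ps + 1 ≤ xiC k v ∧ xiC k v ≤ K ∧ ι v = 0) ∨
        (xiC k v = xiC k ps ∧ -K ≤ upC k v ∧ upC k v ≤ upC k ps - 1 ∧ ι v = 0), ?_, ?_, ?_⟩
    · rintro v (h | h) <;> exact h.2.2.2
    · intro vs h1 h2
      obtain ⟨Qt, hQ, hend, hlast, hmem, hnd, hnew, hreg⟩ := hdata vs h1 h2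
      refine ⟨Qt, hQ, hend, hlast, fun v hv => ?_, hnd, hnew, hreg⟩
      rcases hmem v hv with h | h | h
      exacts [Or.inl (Or.inl h), Or.inl (Or.inr h), Or.inr h]
    · intro u hFu1 hFu2 hGu1 hGu2 huin
      obtain ⟨hu1, hu2⟩ := hK₀in u huin
      obtain ⟨eF, eG⟩ := hdiff u
      -- the separation `T p⋆ ≤ T u - 8`
      have hS : xiC k ps + upC k ps ≤ xiC k u + upC k u - 8 := by
        by_contra hc
        have hc' : (-7 : ℝ) ≤ ((xiC k ps + upC k ps - (xiC k u + upC k u) : ℤ) : ℝ) := by exact_mod_cast (by omega)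
        have m : Real.sqrt 2 / 2 * δ * (-7) ≤ Real.sqrt 2 / 2 * δ * ((xiC k ps + upC k ps - (xiC k u + upC k u) : ℤ) : ℝ) :=
          mul_le_mul_of_nonneg_left hc' (by positivity)
        have key : -(7 * δ) ≤ Gp - Gk k (dRot c (meshPoint δ u)) := by rw [eG]; nlinarith
        rcases hcase with hG | ⟨hF, hGa3⟩
        · linarith
        · linarith
      refine ⟨fun v hv => ?_, fun v hv => ?_⟩
      · exact safeVertex_of_bot hK hu2 hp1' hS (Or.inl hv)
      · exact safeVertex_of_bot hK hu2 hp1' hS (Or.inr (hgadget u v hv))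
  ---------------------------------------------------------------- the decision
  by_cases h1 : gam' α β k ≤ Gp
  · exact hEAST (Or.inl h1)
  by_cases h2 : Fp ≤ -gam α β k
  · exact hTOP h2
  by_cases h3 : Gp ≤ -gam' α β k
  · exact hBOT (Or.inl h3)
  -- `p⋆` is beyond side `k`
  have hF : gam α β k ≤ Fp := by
    have := hpsout
    rw [mem_carrier_iff_frame hcar' k, not_and_or, not_lt, not_lt] at this
    rcases this with h | h
    · rcases le_abs'.1 h with h | h
      · exact absurd h h2
      · exact h
    · rcases le_abs'.1 h with h | h
      · exact absurd h h3
      · exact absurd h h1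
  have hopp : -gam α β k < Fa := by linarith [hρF.1, hρF.2]
  rcases tangential_dichotomy_of_not_mem_openSegment hpk hqk hsp0 hsqL hbd hopp haseg with h | h
  · exact hBOT (Or.inr ⟨hF, h⟩)
  · exact hEAST (Or.inr ⟨hF, h⟩)

end Summit.CriticalPhenomena.CardyFormulaZ2.Cruxes.ParafermionToSLESixFamilies.PotentialDarbouxPicardDiamond

end
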